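import Mathlib
import HarnessLib
import Summits.NavierStokesRegularity.NavierStokesRegularity.Theses.StretchingWellBinding
import Summits.NavierStokesRegularity.NavierStokesRegularity.Theses.TypeILiouville
import Summits.NavierStokesRegularity.NavierStokesRegularity.Theorems.LerayQuarterDissipationRecordTimeTypeI
import Summits.NavierStokesRegularity.NavierStokesRegularity.Theorems.StretchingWellBindingEnstrophyQuarterLawLambBudgetAssembly
import Summits.NavierStokesRegularity.NavierStokesRegularity.Theses.HalfHolderEnergy
import Summits.NavierStokesRegularity.NavierStokesRegularity.Theorems.StretchingWellBindingEnstrophyQuarterLawWindowToSlice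
import Summits.NavierStokesRegularity.NavierStokesRegularity.Theorems.StretchingWellBindingEnstrophyQuarterLawToEnergyHalfHolder
import Summits.NavierStokesRegularity.NavierStokesRegularity.Theorems.StretchingWellBindingEnstrophyQuarterLawGradientTypeI
import Summits.NavierStokesRegularity.NavierStokesRegularity.Theorems.StretchingWellBindingEnstrophyQuarterLawStretchingSplit

/-!
# Shelf 1574, LINE 7 twin `lamb_budget_vorticity`: ASSEMBLY — the quarter law is EXACTLY the Type-I wall plus
# volume sparseness of the high-vorticity set (by name, kernel-hard)

Helper file (`--supports stmt-NavierStokesRegularity-1574 --as helper`). With the twin's engine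
(`LambBudget.stretchingSplit`, file `…StretchingSplit`) and its known stub (`LambBudget.gradientTypeIOfTypeI`, file
`…GradientTypeI`) now tree theorems, ns-idea-9's TWIN FORM of LINE 7
(`Cruxes/EnstrophyQuarterLaw/Lines/lamb_budget_vorticity.lean` b61a884b4856, idea-crit-8 V30a) becomes a set of
UNCONDITIONAL implications between named open statements:

* `vorticitySparse_of_sliceLaw` — ns-idea-9's sorry-free Chebyshev lemma (Theorems copy, predicates unfolded):
  the slice quarter law forces `|{|curl u(s)| > c₂/(T−s)}| ≤ (K⁺/(c₂²ν^{3/2})) (ν(T−s))^{3/2}` at EVERY `c₂ > 0`;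
* `enstrophyQuarterLaw_of_noTypeII_of_vorticitySparsenessLaw` — the twin's skeleton theorem
  `EnstrophyQuarterLaw ⇐ 0056 ∧ B_ω` with `B_ω = VorticitySparsenessLaw` UNFOLDED VERBATIM and the stubs
  `stub_stretchingSplit`, `stub_gradientTypeI` discharged;
* `noTypeII_and_vorticitySparsenessLaw_of_enstrophyQuarterLaw` and the headline
  `enstrophyQuarterLaw_iff_noTypeII_and_vorticitySparsenessLaw :
     StretchingWellBinding.EnstrophyQuarterLaw ↔ (TypeILiouville.TypeIliouvilleNoTypeII ∧ B_ω)` —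
  the converse uses the tree's record-time lemma (`lerayQuarterDissipation_recordTimeTypeI_proof`: slice law ⇒
  sup-rate Type I, stmt-22147) and Chebyshev at `c₂ = 1/8`;
* `sliceLaw_iff_typeI_and_vorticitySparse` — PER SOLUTION, hypothesis-free: for every `c₂ ∈ (0,1/4)`,
  slice quarter law ⟺ (sup-rate Type I ∧ high-vorticity volume sparseness at `c₂`);
* `enstrophyQuarterLaw_iff_noTypeII_and_volumeSparsenessLaw` — the same closure for the MAIN form of LINE 7
  (velocity fast set, `B = VolumeSparsenessLaw` unfolded; `⇐` is ns-hhe-c1 g3's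
  `enstrophyQuarterLaw_of_noTypeII_of_volumeSparsenessLaw`, p625040; `⇒` by record time + `volumeSparseOfSlice` at
  `c₀ = 1/2`): `EnstrophyQuarterLaw ⟺ 0056 ∧ B`, kernel-hard;
* `enstrophyQuarterLaw_iff_energyHalfHolder_and_noTypeII` — for the record, LINE 2 `window_average`'s
  factorisation `EnstrophyQuarterLaw ⟺ EnergyHalfHolder (25161) ∧ 0056` by name (converters p606985 / p608800 of
  ns-hhe-c1 g0 + record time), so that the shelf's three by-name closures sit in one module.

So on shelf 1574 the crux is, in the kernel, EXACTLY «Type I (0056) ∧ one Lebesgue-measure inequality on one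
vorticity super-level set» — the twin's advertised factorisation `EnstrophyQuarterLaw ⟺ 0056 ∧ B_ω`.

HONEST FRAMING: edges between OPEN statements (`EnstrophyQuarterLaw` 1574, `TypeIliouvilleNoTypeII` 0056,
`VorticitySparsenessLaw` B_ω); nothing about Navier–Stokes regularity is asserted and no crux is closed. Credit:
the decomposition, the statements and `vorticitySparse_of_sliceLaw` are ns-idea-9 g3's; this seat only lands them.
No summit statement is proved.
-/

noncomputable section

-- the summit-side namespace repeats a component by design (D-0017)
set_option linter.dupNamespace false

namespace Summit.NavierStokesRegularity.NavierStokesRegularity.Theorems.EnstrophyQuarterLaw.LambBudget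

open Set MeasureTheory Function Metric Filter Topology
open scoped ENNReal NNReal
open Literature.Analysis.FluidPDE
open Summit.NavierStokesRegularity.NavierStokesRegularity

/-! ### Chebyshev: the slice law forces high-vorticity volume sparseness at every threshold -/

/-- **The quarter law forces vorticity volume sparseness at EVERY threshold** (`vorticitySparse_of_sliceLaw` of
`Lines/lamb_budget_vorticity.lean`, predicates unfolded): Chebyshev at the single level `c₂/(T−s)`,
`|W(s)| ≤ Z(s)(T−s)²/c₂² ≤ (K/c₂²)(T−s)^{3/2}`, constant `N = K⁺/(c₂² √ν³)`.
-- adapted verbatim from Cruxes/EnstrophyQuarterLaw/Lines/lamb_budget_vorticity.lean (ns-idea-9 g3). [folklore] -/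
theorem vorticitySparse_of_sliceLaw {c₂ ν T : ℝ} (hc₂ : 0 < c₂) (hν : 0 < ν)
    {u : ℝ → EuclideanSpace ℝ (Fin 3) → EuclideanSpace ℝ (Fin 3)} {p : ℝ → EuclideanSpace ℝ (Fin 3) → ℝ}
    (hmax : IsMaximalSmoothSolution ν 0 u p T)
    (hZ : ∃ K : ℝ, ∀ t ∈ Set.Ico 0 T, ∫⁻ x, ‖curl (u t) x‖ₑ ^ 2 ≤ ENNReal.ofReal (K / Real.sqrt (T - t))) :
    ∃ N : ℝ, ∀ s ∈ Set.Ico 0 T,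
      volume {x | c₂ / (T - s) < ‖curl (u s) x‖} ≤ ENNReal.ofReal (N * Real.sqrt (ν * (T - s)) ^ 3) := by
  obtain ⟨K, hK⟩ := hZ
  refine ⟨max K 0 / (c₂ ^ 2 * Real.sqrt ν ^ 3), fun s hs => ?_⟩
  have hTs : 0 < T - s := sub_pos.2 hs.2
  have hr : 0 < Real.sqrt (T - s) := Real.sqrt_pos.2 hTs
  have hsν : 0 < Real.sqrt ν := Real.sqrt_pos.2 hν
  set lam : ℝ := c₂ / (T - s) with hlam
  have hlam_pos : 0 < lam := div_pos hc₂ hTs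
  -- measurability of the slice integrand from smoothness of the classical slice
  have hC1 : ContDiff ℝ 1 (u s) :=
    ((hmax.isClassicalNSSolutionOn.contDiff_velocity hs).of_le (by norm_cast))
  have hmeas : AEMeasurable (fun x => ‖curl (u s) x‖ₑ ^ 2) volume :=
    ((continuous_curl hC1).measurable.enorm.pow_const 2).aemeasurable
  -- Chebyshev at the level `lam²`
  have hsub : {x | c₂ / (T - s) < ‖curl (u s) x‖} ⊆
      {x | ENNReal.ofReal (lam ^ 2) ≤ ‖curl (u s) x‖ₑ ^ 2} := by
    intro x hx
    simp only [Set.mem_setOf_eq] at hx ⊢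
    rw [← ofReal_norm, ← ENNReal.ofReal_pow (norm_nonneg _)]
    exact ENNReal.ofReal_le_ofReal (by nlinarith [hlam_pos, hx, norm_nonneg (curl (u s) x)])
  have hε0 : ENNReal.ofReal (lam ^ 2) ≠ 0 := (ENNReal.ofReal_pos.2 (pow_pos hlam_pos 2)).ne'
  have hcheb := meas_ge_le_lintegral_div hmeas hε0 ENNReal.ofReal_ne_top
  have hW : volume {x | c₂ / (T - s) < ‖curl (u s) x‖} ≤
      ENNReal.ofReal (K / Real.sqrt (T - s)) / ENNReal.ofReal (lam ^ 2) :=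
    (measure_mono hsub).trans (hcheb.trans (ENNReal.div_le_div_right (hK s hs) _))
  refine hW.trans ?_
  rw [← ENNReal.ofReal_div_of_pos (pow_pos hlam_pos 2)]
  apply ENNReal.ofReal_le_ofReal
  -- real arithmetic: K/√(T−s)/lam² = K (√(T−s))³ / c₂²  ≤  maxK0/(c₂² √ν³) · (√ν √(T−s))³
  have hsplit : Real.sqrt (ν * (T - s)) = Real.sqrt ν * Real.sqrt (T - s) := Real.sqrt_mul hν.le _
  rw [hsplit, hlam]
  have hc2 : 0 < c₂ ^ 2 := pow_pos hc₂ 2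
  set r := Real.sqrt (T - s) with hr_def
  have hTs' : T - s = r ^ 2 := (Real.sq_sqrt hTs.le).symm
  have hr0 : r ≠ 0 := hr.ne'
  have hc0 : c₂ ≠ 0 := hc₂.ne'
  have hν0 : Real.sqrt ν ≠ 0 := hsν.ne'
  rw [hTs']
  calc K / r / (c₂ / r ^ 2) ^ 2
        = K * r ^ 3 / c₂ ^ 2 := by
          field_simp
    _ ≤ max K 0 * r ^ 3 / c₂ ^ 2 := by
          gcongr
          exact le_max_left _ _
    _ = max K 0 / (c₂ ^ 2 * Real.sqrt ν ^ 3) * (Real.sqrt ν * r) ^ 3 := by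
          field_simp

/-! ### The twin's compositions, by name -/

/-- **The skeleton theorem of the LINE 7 twin with `stub_stretchingSplit` and `stub_gradientTypeI` discharged:
`TypeIliouvilleNoTypeII → VorticitySparsenessLaw → EnstrophyQuarterLaw`** (`VorticitySparsenessLaw` — the twin's
crux `B_ω`: for SOME `c₂ ∈ (0,1/4)`, at every first blow-up the high-vorticity set `{|curl u(s)| > c₂/(T−s)}` has
measure `≤ N (ν(T−s))^{3/2}` — UNFOLDED VERBATIM). Conditional edge only. [folklore] -/
theorem enstrophyQuarterLaw_of_noTypeII_of_vorticitySparsenessLaw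
    (hII : Theses.TypeILiouville.TypeIliouvilleNoTypeII)
    (hB : ∃ c₂ : ℝ, 0 < c₂ ∧ c₂ < 1 / 4 ∧
      ∀ (ν T : ℝ), 0 < ν → 0 < T →
        ∀ (u : ℝ → EuclideanSpace ℝ (Fin 3) → EuclideanSpace ℝ (Fin 3))
          (p : ℝ → EuclideanSpace ℝ (Fin 3) → ℝ),
        IsMaximalSmoothSolution ν 0 u p T → IsLerayHopfOn T ν 0 (u 0) u → HasRapidSpatialDecay (u 0) →
        ∃ N : ℝ, ∀ s ∈ Set.Ico 0 T,
          volume {x : EuclideanSpace ℝ (Fin 3) | c₂ / (T - s) < ‖curl (u s) x‖} ≤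
            ENNReal.ofReal (N * Real.sqrt (ν * (T - s)) ^ 3)) :
    Theses.StretchingWellBinding.EnstrophyQuarterLaw := by
  intro ν T hν hT u p hmax hLH hdec
  obtain ⟨c₂, hc₂, hc₂', hVS⟩ := hB
  have hTI : IsTypeIBlowup u T := hII ν T hν hT u p hmax hLH hdec
  exact stretchingSplit c₂ hc₂ hc₂' ν T hν hT u p hmax hLH hdec
    (gradientTypeIOfTypeI ν T hν hT u p hmax hLH hdec hTI) (hVS ν T hν hT u p hmax hLH hdec)

/-- **Converse at shelf level:** the quarter law forces the Type-I wall (record-time lemma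
`lerayQuarterDissipation_recordTimeTypeI_proof`, stmt-22147) AND `B_ω` at EVERY threshold `c₂ > 0` (Chebyshev).
[folklore] -/
theorem noTypeII_and_vorticitySparse_of_enstrophyQuarterLaw
    (hE : Theses.StretchingWellBinding.EnstrophyQuarterLaw) :
    Theses.TypeILiouville.TypeIliouvilleNoTypeII ∧
      ∀ c₂ : ℝ, 0 < c₂ →
      ∀ (ν T : ℝ), 0 < ν → 0 < T →
        ∀ (u : ℝ → EuclideanSpace ℝ (Fin 3) → EuclideanSpace ℝ (Fin 3))
          (p : ℝ → EuclideanSpace ℝ (Fin 3) → ℝ),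
        IsMaximalSmoothSolution ν 0 u p T → IsLerayHopfOn T ν 0 (u 0) u → HasRapidSpatialDecay (u 0) →
        ∃ N : ℝ, ∀ s ∈ Set.Ico 0 T,
          volume {x : EuclideanSpace ℝ (Fin 3) | c₂ / (T - s) < ‖curl (u s) x‖} ≤
            ENNReal.ofReal (N * Real.sqrt (ν * (T - s)) ^ 3) := by
  refine ⟨?_, ?_⟩
  · intro ν T hν hT u p hmax hLH hdec
    obtain ⟨K, hK⟩ := hE ν T hν hT u p hmax hLH hdec
    exact Theorems.lerayQuarterDissipation_recordTimeTypeI_proof ν T hν hT u p hmax.1 hLH hdec K hK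
  · intro c₂ hc₂ ν T hν hT u p hmax hLH hdec
    exact vorticitySparse_of_sliceLaw hc₂ hν hmax (hE ν T hν hT u p hmax hLH hdec)

/-- **The twin's factorisation, kernel-hard: `EnstrophyQuarterLaw ⟺ 0056 ∧ B_ω`** (`B_ω = VorticitySparsenessLaw`
unfolded verbatim; `⇐` by `gradientTypeIOfTypeI` + `stretchingSplit`, `⇒` by the record-time lemma and Chebyshev
at `c₂ = 1/8`). On shelf 1574 the crux is EXACTLY the Type-I wall plus one Lebesgue-measure inequality on one
vorticity super-level set. Both sides OPEN; no crux is closed here. [folklore] -/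
theorem enstrophyQuarterLaw_iff_noTypeII_and_vorticitySparsenessLaw :
    Theses.StretchingWellBinding.EnstrophyQuarterLaw ↔
      (Theses.TypeILiouville.TypeIliouvilleNoTypeII ∧
        ∃ c₂ : ℝ, 0 < c₂ ∧ c₂ < 1 / 4 ∧
          ∀ (ν T : ℝ), 0 < ν → 0 < T →
            ∀ (u : ℝ → EuclideanSpace ℝ (Fin 3) → EuclideanSpace ℝ (Fin 3))
              (p : ℝ → EuclideanSpace ℝ (Fin 3) → ℝ),
            IsMaximalSmoothSolution ν 0 u p T → IsLerayHopfOn T ν 0 (u 0) u → HasRapidSpatialDecay (u 0) →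
            ∃ N : ℝ, ∀ s ∈ Set.Ico 0 T,
              volume {x : EuclideanSpace ℝ (Fin 3) | c₂ / (T - s) < ‖curl (u s) x‖} ≤
                ENNReal.ofReal (N * Real.sqrt (ν * (T - s)) ^ 3)) := by
  constructor
  · intro hE
    obtain ⟨hII, hB⟩ := noTypeII_and_vorticitySparse_of_enstrophyQuarterLaw hE
    exact ⟨hII, 1 / 8, by norm_num, by norm_num, hB (1 / 8) (by norm_num)⟩
  · rintro ⟨hII, hB⟩
    exact enstrophyQuarterLaw_of_noTypeII_of_vorticitySparsenessLaw hII hB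

/-- **The twin's headline, per solution and hypothesis-free:** for every `c₂ ∈ (0,1/4)` and every maximal
classical Leray–Hopf solution from a rapidly decaying datum, the slice quarter law
`∃ K, ∫|curl u(t)|² ≤ K/√(T−t)` on `[0,T)` holds IFF the blow-up is sup-rate Type I AND the high-vorticity set
`{|curl u(s)| > c₂/(T−s)}` is volume sparse (`⇒`: record-time Type I + Chebyshev; `⇐`: `gradientTypeIOfTypeI` +
`stretchingSplit`). [folklore] -/
theorem sliceLaw_iff_typeI_and_vorticitySparse {c₂ : ℝ} (hc₂ : 0 < c₂) (hc₂' : c₂ < 1 / 4) {ν T : ℝ}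
    (hν : 0 < ν) (hT : 0 < T) {u : ℝ → EuclideanSpace ℝ (Fin 3) → EuclideanSpace ℝ (Fin 3)}
    {p : ℝ → EuclideanSpace ℝ (Fin 3) → ℝ} (hmax : IsMaximalSmoothSolution ν 0 u p T)
    (hLH : IsLerayHopfOn T ν 0 (u 0) u) (hdec : HasRapidSpatialDecay (u 0)) :
    (∃ K : ℝ, ∀ t ∈ Set.Ico 0 T, ∫⁻ x, ‖curl (u t) x‖ₑ ^ 2 ≤ ENNReal.ofReal (K / Real.sqrt (T - t))) ↔
      (IsTypeIBlowup u T ∧ ∃ N : ℝ, ∀ s ∈ Set.Ico 0 T,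
        volume {x : EuclideanSpace ℝ (Fin 3) | c₂ / (T - s) < ‖curl (u s) x‖} ≤
          ENNReal.ofReal (N * Real.sqrt (ν * (T - s)) ^ 3)) := by
  constructor
  · rintro ⟨K, hK⟩
    have hTI : IsTypeIBlowup u T :=
      Theorems.lerayQuarterDissipation_recordTimeTypeI_proof ν T hν hT u p hmax.1 hLH hdec K hK
    exact ⟨hTI, vorticitySparse_of_sliceLaw hc₂ hν hmax ⟨K, hK⟩⟩
  · rintro ⟨hTI, hV⟩
    exact stretchingSplit c₂ hc₂ hc₂' ν T hν hT u p hmax hLH hdec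
      (gradientTypeIOfTypeI ν T hν hT u p hmax hLH hdec hTI) hV

/-- **LINE 7, MAIN form — the same closure: `EnstrophyQuarterLaw ⟺ 0056 ∧ B`** (`B = VolumeSparsenessLaw` of
`Lines/lamb_budget.lean` unfolded verbatim: for SOME `c₀ ∈ (0,1)` the velocity fast set
`{|u(s)| > c₀√(ν/(T−s))}` has measure `≤ N (ν(T−s))^{3/2}` at every first blow-up). `⇐` is ns-hhe-c1 g3's
`enstrophyQuarterLaw_of_noTypeII_of_volumeSparsenessLaw` (p625040); `⇒` by the record-time lemma and
`volumeSparseOfSlice` (stub 6, p621487) at `c₀ = 1/2`. Both sides OPEN; no crux is closed here. [folklore] -/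
theorem enstrophyQuarterLaw_iff_noTypeII_and_volumeSparsenessLaw :
    Theses.StretchingWellBinding.EnstrophyQuarterLaw ↔
      (Theses.TypeILiouville.TypeIliouvilleNoTypeII ∧
        ∃ c₀ : ℝ, 0 < c₀ ∧ c₀ < 1 ∧
          ∀ (ν T : ℝ), 0 < ν → 0 < T →
            ∀ (u : ℝ → EuclideanSpace ℝ (Fin 3) → EuclideanSpace ℝ (Fin 3))
              (p : ℝ → EuclideanSpace ℝ (Fin 3) → ℝ),
            IsMaximalSmoothSolution ν 0 u p T → IsLerayHopfOn T ν 0 (u 0) u → HasRapidSpatialDecay (u 0) →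
            ∃ N : ℝ, ∀ s ∈ Set.Ico 0 T,
              volume {x : EuclideanSpace ℝ (Fin 3) | c₀ * Real.sqrt (ν / (T - s)) < ‖u s x‖} ≤
                ENNReal.ofReal (N * Real.sqrt (ν * (T - s)) ^ 3)) := by
  constructor
  · intro hE
    refine ⟨(noTypeII_and_vorticitySparse_of_enstrophyQuarterLaw hE).1, 1 / 2, by norm_num, by norm_num, ?_⟩
    intro ν T hν hT u p hmax hLH hdec
    exact volumeSparseOfSlice (1 / 2) (by norm_num) ν T hν hT u p hmax hLH hdec (hE ν T hν hT u p hmax hLH hdec)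
  · rintro ⟨hII, hB⟩
    exact enstrophyQuarterLaw_of_noTypeII_of_volumeSparsenessLaw hII hB

/-- **LINE 2 `window_average`, for the record — `EnstrophyQuarterLaw ⟺ EnergyHalfHolder ∧ 0056` by name:**
`⇒` by `energyHalfHolder_of_enstrophyQuarterLaw` (p606985, one integration) and the record-time lemma (stmt-22147);
`⇐` by `enstrophyQuarterLaw_of_noTypeII_of_energyHalfHolder` (p608800, the `WindowToSlice` converter). Route
HalfHolderEnergy's advertised factorisation of the shelf residual into an energy-curve half and a rate half,
kernel-hard; all three statements OPEN; no crux is closed here. [folklore] -/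
theorem enstrophyQuarterLaw_iff_energyHalfHolder_and_noTypeII :
    Theses.StretchingWellBinding.EnstrophyQuarterLaw ↔
      (Theses.HalfHolderEnergy.EnergyHalfHolder ∧ Theses.TypeILiouville.TypeIliouvilleNoTypeII) := by
  constructor
  · intro hE
    exact ⟨Theorems.energyHalfHolder_of_enstrophyQuarterLaw hE,
      (noTypeII_and_vorticitySparse_of_enstrophyQuarterLaw hE).1⟩
  · rintro ⟨hW, hII⟩
    exact Theorems.enstrophyQuarterLaw_of_noTypeII_of_energyHalfHolder hII hW

end Summit.NavierStokesRegularity.NavierStokesRegularity.Theorems.EnstrophyQuarterLaw.LambBudget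

end
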